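import Summits.AtomisticToContinuum.Crystallization.Theorems.ChartedPlanarOrderPairModulusSharpB
import Mathlib.Analysis.Calculus.Deriv.MeanValue
import Mathlib.Analysis.InnerProductSpace.Calculus
import Mathlib.Analysis.Calculus.SmoothSeries

/-!
# Charted planar order — the channel JACOBIAN: Hessian-certificate ingestion format for the channel leaves (lens-3, g25 Part B; TAG 182)
— part 1/2 (§1–§4: secant lemma, pair/layer Jacobian, differentiability)

The four channel leaves of record (`…TubeChannelsTS.AdjacentChannelRefT/S`, `FarChannelBelowRefT/S`) bound the SECANT form
`⟪G u − G u′, u − u′⟫` of the offset map `G u = layerForce a b (−u)` on convex windows (`tube w' (1/40) m`, resp. the span balls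
`closedBall (w' l − w' k) (s/40)`). This module turns them into statements a finite certificate can discharge:

* §1 a monotone-operator lemma (mean value along the segment): a lower bound `Q` for the Jacobian form `⟪J(x)D, D⟫`, `D = u − u′`, on the
  window gives `Q ≤` secant form; block bounds `(α_T, α_N, γ)` (tangential / normal / cross, w.r.t. a unit normal `ν`) with a weight `θ`
  give the channel constants `l_T = α_T − θγ`, `l_N = α_N − γ/θ` (`channel_of_blocks`); hence `IsAdjacentChannelMono` /
  `IsFarChannelModulusBelow` from Jacobian block bounds (`…_of_jacobian`, `…_of_blocks`).
* §2–§3 the explicit PAIR JACOBIAN `pairJac x = radial(‖x‖²)·id + 2 radial′(‖x‖²)·(x ⊗ x)` of `pairForce x = (‖x‖⁻¹⁴ − ‖x‖⁻⁸) x`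
  (`hasFDerivAt_pairForce`, `x ≠ 0`) with the operator-norm bound `‖pairJac x‖ ≤ modulus r` for `‖x‖ ≥ r > 0`.
* §4 the LAYER JACOBIAN `layerJac a b v = Σ_{ℤ²} pairJac (v + l)` and `HasFDerivAt (layerForce a b) (layerJac a b v) v` off the layer
  plane (termwise differentiation with the summable majorant of `…LatticeSmear.tsum_modulus_le_smear` on a `d`-ball).
* §5 INGESTION: the interlayer Hessian `hess a b u = −layerJac a b (−u)`; on the configurations of record every window point is regular
  (`regularWindows`: heights `≥ 31/50` w.r.t. a unit normal, cell radius `≤ 23/25`), so Hessian block bounds ALONE give the leaves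
  (`isAdjacentChannelMono_of_hess`, `isFarChannelModulusBelow_of_hess`, the Ref wrappers `adjacentChannelRefT/S_of_hess`,
  `farChannelBelowRefT/S_of_hess` from the certificate predicates `HessCertAdj Φ α_T α_N γ`, `HessCertFar Φ α_T α_N γ s₀`), and the
  ENDPOINT `tubeConvexRef_of_hessCerts₆`: four Hessian certificates (adjacent + spans `2..5`, T and S branch) + weights + the closing
  arithmetic of `…PairModulusSharp.tubeConvexRef_record_of_branch_certs₆` ⇒ `TubeConvexRef (17/16) (1/40)`; and the Hessian form as an
  absolutely convergent lattice series of explicit rational functions (`inner_hess_eq_tsum`, `inner_pairJac`) for matching a computed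
  truncation against `hess`.

No `sorry`; axioms `propext, Classical.choice, Quot.sound`.
-/

noncomputable section

namespace Summit.AtomisticToContinuum.Crystallization.Theorems.ChartedPlanarOrderChannelJacobian

open Metric Set
open scoped RealInnerProductSpace
open Summit.AtomisticToContinuum.Crystallization.Theorems.ChartedPlanarOrderRigidityDoor (E3)
open Summit.AtomisticToContinuum.Crystallization.Theorems.ChartedPlanarOrderProfileSlavingLJ (pairForce layerForce incr offsetOf tube)
open Summit.AtomisticToContinuum.Crystallization.Theorems.ChartedPlanarOrderTubeMonotoneSplit (norm_offsetOf_sub_le)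
open Summit.AtomisticToContinuum.Crystallization.Theorems.ChartedPlanarOrderTubeChannels (tng IsAdjacentChannelMono IsFarChannelModulusBelow)
open Summit.AtomisticToContinuum.Crystallization.Theorems.ChartedPlanarOrderPairModulus (modulus modulus_nonneg exists_planar
  summable_layer)
open Summit.AtomisticToContinuum.Crystallization.Theorems.ChartedPlanarOrderStackedLayerGeometry (inner_period_combo)
open Summit.AtomisticToContinuum.Crystallization.Theorems.ChartedPlanarOrderLayerFrame (norm_sq_add_smul_normal norm_sq_eq_planar_add_height)
open Summit.AtomisticToContinuum.Crystallization.Theorems.ChartedPlanarOrderLatticeSmear (norm_sq_lin tsum_modulus_le_smear)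
open Summit.AtomisticToContinuum.Crystallization.Theorems.ChartedPlanarOrderHeightFloor (cleanStackedWindows)
open Summit.AtomisticToContinuum.Crystallization.Theorems.ChartedPlanarOrderLayerForceLipschitz (le_inner_offsetOf)
open Summit.AtomisticToContinuum.Crystallization.Theorems.ChartedPlanarOrderDensityDichotomy (IsSep μS)
open Summit.AtomisticToContinuum.Crystallization.Theorems.ChartedPlanarOrderDoorLayered (Layered)
open Summit.AtomisticToContinuum.Crystallization.Theorems.ChartedPlanarOrderProfileSlavingLJ (IsStacked gapStress)
open Summit.AtomisticToContinuum.Crystallization.Theorems.OverbindingBudgetScaleWidening (IsCleanW)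
open Summit.AtomisticToContinuum.Crystallization.Theorems.OverbindingBudgetPeriodicCleanOrStrained (UniformlyClean)
open Summit.AtomisticToContinuum.Crystallization.Theorems.ChartedPlanarOrderTubeConvex (TubeConvexRef)
open Summit.AtomisticToContinuum.Crystallization.Theorems.ChartedPlanarOrderTubeChannelsTS (AdjacentChannelRefT AdjacentChannelRefS
  FarChannelBelowRefT FarChannelBelowRefS)
open Summit.AtomisticToContinuum.Crystallization.Theorems.ChartedPlanarOrderPairModulusSharp (tubeConvexRef_record_of_branch_certs₆)

/-! ## §1 Secant lower bounds from a Jacobian lower bound along the segment -/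

/-- MONOTONE-OPERATOR LEMMA: if `G` is differentiable on a convex window `W` and the Jacobian form in the direction `u − u′` is `≥ Q` on `W`,
then the secant form is `≥ Q`: `Q ≤ ⟪G u − G u′, u − u′⟫`. [folklore: mean value inequality for `t ↦ ⟪G(u′ + t(u−u′)), u−u′⟫`] -/
theorem le_inner_sub_of_hasFDerivAt {G : E3 → E3} {G' : E3 → (E3 →L[ℝ] E3)} {W : Set E3} (hW : Convex ℝ W)
    (hG : ∀ x ∈ W, HasFDerivAt G (G' x) x) {u u' : E3} (hu : u ∈ W) (hu' : u' ∈ W) {Q : ℝ}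
    (hQ : ∀ x ∈ W, Q ≤ ⟪G' x (u - u'), u - u'⟫) : Q ≤ ⟪G u - G u', u - u'⟫ := by
  set D := u - u' with hD
  set φ : ℝ → ℝ := fun t => ⟪G (u' + t • D), D⟫ with hφ
  have hseg : ∀ t ∈ Icc (0 : ℝ) 1, u' + t • D ∈ W := by
    intro t ht
    have h := hW hu' hu (by linarith [ht.2] : (0 : ℝ) ≤ 1 - t) ht.1 (by ring)
    have he : (1 - t) • u' + t • u = u' + t • D := by rw [hD, smul_sub, sub_smul, one_smul]; abel
    rwa [he] at h
  have hderiv : ∀ t ∈ Icc (0 : ℝ) 1, HasDerivAt φ ⟪G' (u' + t • D) D, D⟫ t := by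
    intro t ht
    have hp : HasDerivAt (fun s : ℝ => u' + s • D) D t := by
      simpa using ((hasDerivAt_id t).smul_const D).const_add u'
    have hGp : HasDerivAt (fun s : ℝ => G (u' + s • D)) (G' (u' + t • D) D) t :=
      (hG _ (hseg t ht)).comp_hasDerivAt t hp
    have h := hGp.inner ℝ (hasDerivAt_const t D)
    simpa using h
  have hcont : ContinuousOn φ (Icc 0 1) := fun t ht => (hderiv t ht).continuousAt.continuousWithinAt
  have hdiff : DifferentiableOn ℝ φ (interior (Icc 0 1)) := fun t ht =>
    (hderiv t (interior_subset ht)).differentiableAt.differentiableWithinAt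
  have hge : ∀ t ∈ interior (Icc (0 : ℝ) 1), Q ≤ deriv φ t := by
    intro t ht
    rw [(hderiv t (interior_subset ht)).deriv]
    exact hQ _ (hseg t (interior_subset ht))
  have hmv := (convex_Icc (0 : ℝ) 1).mul_sub_le_image_sub_of_le_deriv hcont hdiff hge 0 (left_mem_Icc.2 zero_le_one) 1
    (right_mem_Icc.2 zero_le_one) zero_le_one
  have h1 : φ 1 = ⟪G u, D⟫ := by simp [hφ, hD]
  have h0 : φ 0 = ⟪G u', D⟫ := by simp [hφ]
  rw [h1, h0, ← inner_sub_left] at hmv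
  linarith

/-- CHANNEL ALGEBRA: block bounds `α_T‖D_T‖² + α_N D_N² − 2γ‖D_T‖|D_N|` with `γ ≥ 0` dominate `l_T‖D_T‖² + l_N D_N²` as soon as
`l_T ≤ α_T − θγ`, `l_N ≤ α_N − γ/θ` for a weight `θ > 0` (AM–GM on the cross term). [folklore] -/
theorem channel_of_blocks {αT αN γ θ lT lN : ℝ} (x y : ℝ) (hθ : 0 < θ) (hγ : 0 ≤ γ)
    (hlT : lT ≤ αT - θ * γ) (hlN : lN ≤ αN - γ / θ) :
    lT * x ^ 2 + lN * y ^ 2 ≤ αT * x ^ 2 + αN * y ^ 2 - 2 * γ * (x * y) := by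
  have hamgm : 2 * (x * y) ≤ θ * x ^ 2 + y ^ 2 / θ := by
    have h : 0 ≤ (θ * x - y) ^ 2 / θ := by positivity
    have he : (θ * x - y) ^ 2 / θ = θ * x ^ 2 + y ^ 2 / θ - 2 * (x * y) := by field_simp; ring
    linarith [he ▸ h]
  have h1 : lT * x ^ 2 ≤ (αT - θ * γ) * x ^ 2 := mul_le_mul_of_nonneg_right hlT (sq_nonneg x)
  have h2 : lN * y ^ 2 ≤ (αN - γ / θ) * y ^ 2 := mul_le_mul_of_nonneg_right hlN (sq_nonneg y)
  have h3 : γ * (2 * (x * y)) ≤ γ * (θ * x ^ 2 + y ^ 2 / θ) := mul_le_mul_of_nonneg_left hamgm hγ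
  have he : γ * (θ * x ^ 2 + y ^ 2 / θ) = θ * γ * x ^ 2 + γ / θ * y ^ 2 := by field_simp
  nlinarith [he]

/-! ## §2 The certificate format: channel leaves from Jacobian (Hessian) block bounds on the windows -/

/-- ★ CHᴬ from a JACOBIAN CERTIFICATE: if `u ↦ layerForce a b (−u)` is differentiable on each adjacent window `tube w ρ m` with Jacobian `J u`
whose form dominates the channel form, `l_T‖D_T‖² + l_N D_N² ≤ ⟪J u D, D⟫`, then `IsAdjacentChannelMono a b w ρ ν l_T l_N`. -/
theorem isAdjacentChannelMono_of_jacobian {a b : E3} {w : ℤ → E3} {ρ : ℝ} {ν : E3} {lT lN : ℝ} {J : E3 → (E3 →L[ℝ] E3)}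
    (hJ : ∀ m : ℤ, ∀ u ∈ tube w ρ m, HasFDerivAt (fun u => layerForce a b (-u)) (J u) u)
    (hQ : ∀ m : ℤ, ∀ x ∈ tube w ρ m, ∀ D : E3, lT * ‖tng ν D‖ ^ 2 + lN * ⟪ν, D⟫ ^ 2 ≤ ⟪J x D, D⟫) :
    IsAdjacentChannelMono a b w ρ ν lT lN := fun m u hu u' hu' =>
  le_inner_sub_of_hasFDerivAt (G := fun u => layerForce a b (-u)) (convex_closedBall _ _) (hJ m) hu hu'
    (fun x hx => hQ m x hx (u - u'))

/-- ★ CHᴬ from BLOCK BOUNDS: tangential block `≥ α_T`, normal block `≥ α_N`, cross block `≤ γ` on every adjacent window, and a weight `θ`. -/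
theorem isAdjacentChannelMono_of_blocks {a b : E3} {w : ℤ → E3} {ρ : ℝ} {ν : E3} {αT αN γ θ lT lN : ℝ} {J : E3 → (E3 →L[ℝ] E3)}
    (hJ : ∀ m : ℤ, ∀ u ∈ tube w ρ m, HasFDerivAt (fun u => layerForce a b (-u)) (J u) u)
    (hB : ∀ m : ℤ, ∀ x ∈ tube w ρ m, ∀ D : E3,
      αT * ‖tng ν D‖ ^ 2 + αN * ⟪ν, D⟫ ^ 2 - 2 * γ * (‖tng ν D‖ * |⟪ν, D⟫|) ≤ ⟪J x D, D⟫)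
    (hθ : 0 < θ) (hγ : 0 ≤ γ) (hlT : lT ≤ αT - θ * γ) (hlN : lN ≤ αN - γ / θ) : IsAdjacentChannelMono a b w ρ ν lT lN :=
  isAdjacentChannelMono_of_jacobian hJ fun m x hx D => by
    have h := channel_of_blocks ‖tng ν D‖ |⟪ν, D⟫| hθ hγ hlT hlN
    rw [sq_abs] at h
    exact h.trans (hB m x hx D)

/-- Offsets of tube profiles over the span `(k, l]` lie in the `(l − k)ρ`-ball round the reference offset `w l − w k`. -/
theorem offsetOf_mem_closedBall {w h : ℤ → E3} {ρ : ℝ} {k l : ℤ} (hkl : k ≤ l) (hh : ∀ i, h i ∈ tube w ρ i) :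
    offsetOf h k l ∈ closedBall (w l - w k) ((l - k).toNat * ρ) := by
  rw [mem_closedBall, dist_eq_norm, ← Summit.AtomisticToContinuum.Crystallization.Theorems.ChartedPlanarOrderProfileSlavingLJ.offsetOf_incr
    w hkl]
  refine (norm_offsetOf_sub_le h (incr w) k l).trans ?_
  have hρ : ∀ i ∈ Finset.Ioc k l, ‖h i - incr w i‖ ≤ ρ := fun i _ => by
    have := hh i; rwa [tube, mem_closedBall, dist_eq_norm] at this
  refine (Finset.sum_le_sum hρ).trans ?_
  rw [Finset.sum_const, Int.card_Ioc, nsmul_eq_mul]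

/-- ★ CHꜰ below `s₀` from a JACOBIAN CERTIFICATE on the span windows `closedBall (w l − w k) ((l−k)ρ)`, `2 ≤ l − k < s₀`. -/
theorem isFarChannelModulusBelow_of_jacobian {a b : E3} {w : ℤ → E3} {ρ : ℝ} {ν : E3} {μT μN : ℕ → ℝ} {s₀ : ℕ}
    {J : E3 → (E3 →L[ℝ] E3)}
    (hJ : ∀ k l : ℤ, k + 2 ≤ l → (l - k).toNat < s₀ → ∀ u ∈ closedBall (w l - w k) ((l - k).toNat * ρ),
      HasFDerivAt (fun u => layerForce a b (-u)) (J u) u)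
    (hQ : ∀ k l : ℤ, k + 2 ≤ l → (l - k).toNat < s₀ → ∀ x ∈ closedBall (w l - w k) ((l - k).toNat * ρ), ∀ D : E3,
      -(μT (l - k).toNat * ‖tng ν D‖ ^ 2 + μN (l - k).toNat * ⟪ν, D⟫ ^ 2) ≤ ⟪J x D, D⟫) :
    IsFarChannelModulusBelow a b w ρ ν μT μN s₀ := fun k l hkl hs h h' hh hh' =>
  le_inner_sub_of_hasFDerivAt (G := fun u => layerForce a b (-u)) (convex_closedBall _ _) (hJ k l hkl hs)
    (offsetOf_mem_closedBall (by omega) hh) (offsetOf_mem_closedBall (by omega) hh') (fun x hx => hQ k l hkl hs x hx _)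

/-- ★ CHꜰ below `s₀` from BLOCK BOUNDS per span `s`: softening `a_T(s) ≥ −α_T(s)`, `a_N(s) ≥ −α_N(s)`, cross `≤ γ(s)`, weights `θ(s)`. -/
theorem isFarChannelModulusBelow_of_blocks {a b : E3} {w : ℤ → E3} {ρ : ℝ} {ν : E3} {μT μN : ℕ → ℝ} {s₀ : ℕ}
    {αT αN γ θ : ℕ → ℝ} {J : E3 → (E3 →L[ℝ] E3)}
    (hJ : ∀ k l : ℤ, k + 2 ≤ l → (l - k).toNat < s₀ → ∀ u ∈ closedBall (w l - w k) ((l - k).toNat * ρ),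
      HasFDerivAt (fun u => layerForce a b (-u)) (J u) u)
    (hB : ∀ k l : ℤ, k + 2 ≤ l → (l - k).toNat < s₀ → ∀ x ∈ closedBall (w l - w k) ((l - k).toNat * ρ), ∀ D : E3,
      -(αT (l - k).toNat) * ‖tng ν D‖ ^ 2 + -(αN (l - k).toNat) * ⟪ν, D⟫ ^ 2
        - 2 * γ (l - k).toNat * (‖tng ν D‖ * |⟪ν, D⟫|) ≤ ⟪J x D, D⟫)
    (hθ : ∀ s, 0 < θ s) (hγ : ∀ s, 0 ≤ γ s) (hμT : ∀ s, αT s + θ s * γ s ≤ μT s) (hμN : ∀ s, αN s + γ s / θ s ≤ μN s) :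
    IsFarChannelModulusBelow a b w ρ ν μT μN s₀ :=
  isFarChannelModulusBelow_of_jacobian hJ fun k l hkl hs x hx D => by
    have h := channel_of_blocks (αT := -αT (l - k).toNat) (αN := -αN (l - k).toNat) (lT := -μT (l - k).toNat)
      (lN := -μN (l - k).toNat) ‖tng ν D‖ |⟪ν, D⟫| (hθ (l - k).toNat) (hγ (l - k).toNat) (by linarith [hμT (l - k).toNat])
      (by have := hμN (l - k).toNat; linarith)
    rw [sq_abs] at h
    have h2 := hB k l hkl hs x hx D
    linarith

/-! ## §3 The explicit pair Jacobian `J(x) D = φ(‖x‖²) D + 2φ′(‖x‖²)⟪x, D⟫ x`, `φ(s) = s⁻⁷ − s⁻⁴` -/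

/-- radial profile of the pair force as a function of `s = ‖x‖²`: `pairForce x = radial (‖x‖²) • x`. -/
def radial (s : ℝ) : ℝ := s⁻¹ ^ 7 - s⁻¹ ^ 4

/-- its derivative in `s` (for `s ≠ 0`). -/
def radial' (s : ℝ) : ℝ := -7 * s⁻¹ ^ 8 + 4 * s⁻¹ ^ 5

/-- the pair-force Jacobian at `x ≠ 0` as a continuous linear map. -/
def pairJac (x : E3) : E3 →L[ℝ] E3 :=
  radial (‖x‖ ^ 2) • ContinuousLinearMap.id ℝ E3 + (2 * radial' (‖x‖ ^ 2)) • (innerSL ℝ x).smulRight x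

/-- Unfolding `pairJac`. [folklore] -/
theorem pairJac_apply (x D : E3) : pairJac x D = radial (‖x‖ ^ 2) • D + (2 * radial' (‖x‖ ^ 2) * ⟪x, D⟫) • x := by
  simp [pairJac, smul_smul]

/-- The pair force in radial form. [folklore] -/
theorem pairForce_eq_radial (x : E3) : pairForce x = radial (‖x‖ ^ 2) • x := by
  unfold pairForce radial
  congr 1
  rw [← inv_pow, ← pow_mul, ← pow_mul, inv_pow]

/-- Derivative of the radial profile. [folklore] -/
theorem hasDerivAt_radial {s : ℝ} (hs : s ≠ 0) : HasDerivAt radial (radial' s) s := by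
  have h7 := (hasDerivAt_inv hs).pow 7
  have h4 := (hasDerivAt_inv hs).pow 4
  have h := h7.sub h4
  refine h.congr_deriv ?_
  unfold radial'
  rw [show (s ^ 2)⁻¹ = s⁻¹ ^ 2 by rw [inv_pow]]
  ring

/-- ★ the pair force is differentiable away from the origin with Jacobian `pairJac`. [folklore: product/chain rule] -/
theorem hasFDerivAt_pairForce {x : E3} (hx : x ≠ 0) : HasFDerivAt pairForce (pairJac x) x := by
  have hs : ‖x‖ ^ 2 ≠ 0 := pow_ne_zero 2 (norm_ne_zero_iff.2 hx)
  have hn := (hasStrictFDerivAt_norm_sq x).hasFDerivAt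
  have hc : HasFDerivAt (radial ∘ fun y : E3 => ‖y‖ ^ 2) (radial' (‖x‖ ^ 2) • (2 • innerSL ℝ x)) x :=
    (hasDerivAt_radial hs).comp_hasFDerivAt x hn
  have h := hc.smul (hasFDerivAt_id x)
  have hfun : ((radial ∘ fun y : E3 => ‖y‖ ^ 2) • (id : E3 → E3)) = pairForce := by
    funext y; rw [pairForce_eq_radial]; rfl
  rw [hfun] at h
  refine h.congr_fderiv (ContinuousLinearMap.ext fun D => ?_)
  have e1 : ((radial' (‖x‖ ^ 2) • (2 • innerSL ℝ x)).smulRight ((id : E3 → E3) x)) D = (2 * radial' (‖x‖ ^ 2) * ⟪x, D⟫) • x := by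
    rw [ContinuousLinearMap.smulRight_apply, two_smul]
    simp only [FunLike.coe_smul, Pi.smul_apply, FunLike.coe_add, Pi.add_apply, innerSL_apply_apply,
      id, smul_eq_mul]
    ring_nf
  simp only [FunLike.coe_add, Pi.add_apply, e1, pairJac_apply, FunLike.coe_smul, Pi.smul_apply,
    ContinuousLinearMap.id_apply, Function.comp_apply]

/-- scalar bookkeeping: `|φ(R²)| + 2|φ′(R²)|R² ≤ modulus r` for `0 < r ≤ R`. -/
theorem radial_bound {r R : ℝ} (hr : 0 < r) (hR : r ≤ R) :
    |radial (R ^ 2)| + 2 * |radial' (R ^ 2)| * R ^ 2 ≤ modulus r := by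
  have hR0 : 0 < R := hr.trans_le hR
  have hq : 0 < R⁻¹ := inv_pos.2 hR0
  have e2 : (R ^ 2)⁻¹ = R⁻¹ ^ 2 := by rw [inv_pow]
  have e1 : radial (R ^ 2) = R⁻¹ ^ 14 - R⁻¹ ^ 8 := by unfold radial; rw [e2]; ring
  have e3 : radial' (R ^ 2) = -7 * R⁻¹ ^ 16 + 4 * R⁻¹ ^ 10 := by unfold radial'; rw [e2]; ring
  have h1 : |radial (R ^ 2)| ≤ R⁻¹ ^ 14 + R⁻¹ ^ 8 := by
    rw [e1]; exact (abs_sub _ _).trans (by rw [abs_of_pos (by positivity), abs_of_pos (by positivity)])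
  have h2 : |radial' (R ^ 2)| ≤ 7 * R⁻¹ ^ 16 + 4 * R⁻¹ ^ 10 := by
    rw [e3]
    refine (abs_add_le _ _).trans ?_
    rw [abs_of_nonpos (by have : 0 ≤ 7 * R⁻¹ ^ 16 := by positivity
                          linarith), abs_of_nonneg (by positivity)]
    linarith
  have e4 : (7 * R⁻¹ ^ 16 + 4 * R⁻¹ ^ 10) * R ^ 2 = 7 * R⁻¹ ^ 14 + 4 * R⁻¹ ^ 8 := by
    field_simp
  have hqr : R⁻¹ ≤ r⁻¹ := (inv_le_inv₀ hR0 hr).2 hR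
  have h14 : R⁻¹ ^ 14 ≤ r⁻¹ ^ 14 := pow_le_pow_left₀ hq.le hqr 14
  have h8 : R⁻¹ ^ 8 ≤ r⁻¹ ^ 8 := pow_le_pow_left₀ hq.le hqr 8
  unfold modulus
  nlinarith [sq_nonneg R, h1, h2, mul_le_mul_of_nonneg_right h2 (by positivity : (0 : ℝ) ≤ 2 * R ^ 2)]

/-- ★ operator norm of the pair Jacobian on `{‖x‖ ≥ r}`: `‖J(x)‖ ≤ modulus r = 15r⁻¹⁴ + 9r⁻⁸` (the Lipschitz modulus of `pairForce`). -/
theorem norm_pairJac_le {x : E3} {r : ℝ} (hr : 0 < r) (hx : r ≤ ‖x‖) : ‖pairJac x‖ ≤ modulus r := by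
  refine ContinuousLinearMap.opNorm_le_bound _ (modulus_nonneg r) fun D => ?_
  rw [pairJac_apply]
  have h1 : ‖radial (‖x‖ ^ 2) • D‖ = |radial (‖x‖ ^ 2)| * ‖D‖ := by rw [norm_smul, Real.norm_eq_abs]
  have h2 : ‖(2 * radial' (‖x‖ ^ 2) * ⟪x, D⟫) • x‖ ≤ 2 * |radial' (‖x‖ ^ 2)| * ‖x‖ ^ 2 * ‖D‖ := by
    rw [norm_smul, Real.norm_eq_abs, abs_mul, abs_mul, abs_two]
    have h := abs_real_inner_le_norm x D
    have h0 : 0 ≤ 2 * |radial' (‖x‖ ^ 2)| := by positivity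
    nlinarith [norm_nonneg x, mul_le_mul_of_nonneg_left h h0]
  calc ‖radial (‖x‖ ^ 2) • D + (2 * radial' (‖x‖ ^ 2) * ⟪x, D⟫) • x‖
      ≤ ‖radial (‖x‖ ^ 2) • D‖ + ‖(2 * radial' (‖x‖ ^ 2) * ⟪x, D⟫) • x‖ := norm_add_le _ _
    _ ≤ (|radial (‖x‖ ^ 2)| + 2 * |radial' (‖x‖ ^ 2)| * ‖x‖ ^ 2) * ‖D‖ := by rw [h1]; nlinarith [h2]
    _ ≤ modulus r * ‖D‖ := mul_le_mul_of_nonneg_right (radial_bound hr hx) (norm_nonneg D)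

/-! ## §4 The layer Jacobian `layerJac a b v = Σ_{ℤ²} J(v + l)` and the differentiability of `layerForce` off the layer plane -/

/-- the layer Jacobian: the lattice sum of the pair Jacobians (junk if divergent). -/
def layerJac (a b v : E3) : E3 →L[ℝ] E3 := ∑' ij : ℤ × ℤ, pairJac (v + ((ij.1 : ℝ) • a + (ij.2 : ℝ) • b))

/-- per-site floors on a `d`-ball: with `P_ij` the planar parts of the sites of `v` and `t ≤ |⟪ν, y⟫|`, `‖y − v‖ ≤ d`:
`√(t² + max(‖P_ij‖ − d, 0)²) ≤ ‖y + l_ij‖`. -/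
theorem site_floor {ν a b v y : E3} (hν : ‖ν‖ = 1) (hνa : ⟪ν, a⟫ = 0) (hνb : ⟪ν, b⟫ = 0) {c₁ c₂ t d : ℝ}
    (hc : v - ⟪ν, v⟫ • ν = c₁ • a + c₂ • b) (hty : t ^ 2 ≤ ⟪ν, y⟫ ^ 2) (hyv : ‖y - v‖ ≤ d) (ij : ℤ × ℤ) :
    Real.sqrt (t ^ 2 + (max (‖((ij.1 : ℝ) + c₁) • a + ((ij.2 : ℝ) + c₂) • b‖ - d) 0) ^ 2) ≤
      ‖y + ((ij.1 : ℝ) • a + (ij.2 : ℝ) • b)‖ := by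
  set P : E3 := ((ij.1 : ℝ) + c₁) • a + ((ij.2 : ℝ) + c₂) • b with hP
  -- planar part of the site of `y`
  set Q : E3 := P + ((y - v) - ⟪ν, y - v⟫ • ν) with hQ
  have hPν : ⟪ν, P⟫ = 0 := inner_period_combo hνa hνb _ _
  have hQν : ⟪ν, Q⟫ = 0 := by
    rw [hQ, inner_add_right, hPν, (norm_sq_eq_planar_add_height hν (y - v)).1, add_zero]
  have hsite : y + ((ij.1 : ℝ) • a + (ij.2 : ℝ) • b) = Q + ⟪ν, y⟫ • ν := by
    have hv : v = c₁ • a + c₂ • b + ⟪ν, v⟫ • ν := by rw [← hc, sub_add_cancel]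
    rw [hQ, hP, inner_sub_right, sub_smul]
    nth_rewrite 1 [show y = (y - v) + v from (sub_add_cancel y v).symm]
    nth_rewrite 2 [hv]
    module
  have hnsq : ‖y + ((ij.1 : ℝ) • a + (ij.2 : ℝ) • b)‖ ^ 2 = ‖Q‖ ^ 2 + ⟪ν, y⟫ ^ 2 := by
    rw [hsite, norm_sq_add_smul_normal hν hQν]
  have hQP : ‖P‖ - d ≤ ‖Q‖ := by
    have h1 : ‖(y - v) - ⟪ν, y - v⟫ • ν‖ ≤ ‖y - v‖ := by
      have h2 := (norm_sq_eq_planar_add_height hν (y - v)).2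
      exact (pow_le_pow_iff_left₀ (norm_nonneg _) (norm_nonneg _) two_ne_zero).1 (by nlinarith [sq_nonneg ⟪ν, y - v⟫])
    have h3 : ‖P‖ ≤ ‖Q‖ + ‖(y - v) - ⟪ν, y - v⟫ • ν‖ := by
      have := norm_add_le Q (-((y - v) - ⟪ν, y - v⟫ • ν))
      rw [norm_neg] at this
      have e : Q + -((y - v) - ⟪ν, y - v⟫ • ν) = P := by rw [hQ]; abel
      rwa [e] at this
    linarith
  have hm : (max (‖P‖ - d) 0) ^ 2 ≤ ‖Q‖ ^ 2 :=
    pow_le_pow_left₀ (le_max_right _ _) (max_le hQP (norm_nonneg _)) 2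
  calc Real.sqrt (t ^ 2 + (max (‖P‖ - d) 0) ^ 2) ≤ Real.sqrt (‖y + ((ij.1 : ℝ) • a + (ij.2 : ℝ) • b)‖ ^ 2) :=
        Real.sqrt_le_sqrt (by rw [hnsq]; linarith)
    _ = _ := Real.sqrt_sq (norm_nonneg _)

/-- ★★ DIFFERENTIABILITY OF THE LAYER FORCE off the layer plane, with Jacobian the lattice sum of pair Jacobians: for `a, b ⊥ ν` independent,
`|⟪ν, v⟫| ≥ t + d` (`t, d > 0`) and `(1+ε)t² > (1+1/ε)(d+R_c)²` (summable majorant on the `d`-ball, from `…LatticeSmear`). [folklore: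
termwise differentiation of a normally convergent series of `C¹` maps] -/
theorem hasFDerivAt_layerForce {ν a b v : E3} (hν : ‖ν‖ = 1) (hνa : ⟪ν, a⟫ = 0) (hνb : ⟪ν, b⟫ = 0)
    (hab : LinearIndependent ℝ ![a, b]) {t d Rc ε : ℝ} (ht : 0 < t) (hd : 0 < d) (hε : 0 < ε)
    (hRc : ∀ ζ₁ ζ₂ : ℝ, |ζ₁| ≤ 1 / 2 → |ζ₂| ≤ 1 / 2 → ‖ζ₁ • a + ζ₂ • b‖ ≤ Rc)
    (hT : 0 < (1 + ε) * t ^ 2 - (1 + ε⁻¹) * (d + Rc) ^ 2) (htv : t + d ≤ |⟪ν, v⟫|) :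
    HasFDerivAt (layerForce a b) (layerJac a b v) v := by
  obtain ⟨c₁, c₂, hc⟩ := exists_planar hab hν hνa hνb v
  set m : ℤ × ℤ → ℝ := fun ij => max (‖((ij.1 : ℝ) + c₁) • a + ((ij.2 : ℝ) + c₂) • b‖ - d) 0 with hm
  obtain ⟨hμ, -⟩ := tsum_modulus_le_smear hab hε hRc hT c₁ c₂ (m := m)
    (fun ij => by show _ ≤ max _ 0 + d; linarith [le_max_left (‖((ij.1 : ℝ) + c₁) • a + ((ij.2 : ℝ) + c₂) • b‖ - d) 0])
  have hr : ∀ ij : ℤ × ℤ, 0 < Real.sqrt (t ^ 2 + m ij ^ 2) := fun ij => Real.sqrt_pos.2 (by positivity)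
  -- heights on the ball
  have hty : ∀ y ∈ ball v d, t ^ 2 ≤ ⟪ν, y⟫ ^ 2 := by
    intro y hy
    rw [mem_ball, dist_eq_norm] at hy
    have h1 : |⟪ν, v⟫| - ‖y - v‖ ≤ |⟪ν, y⟫| := by
      have h2 : |⟪ν, v⟫ - ⟪ν, y⟫| ≤ ‖y - v‖ := by
        rw [← inner_sub_right, ← norm_neg (y - v), neg_sub]
        simpa [hν] using abs_real_inner_le_norm ν (v - y)
      linarith [abs_sub_abs_le_abs_sub ⟪ν, v⟫ ⟪ν, y⟫]
    have h3 : t ≤ |⟪ν, y⟫| := by linarith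
    nlinarith [sq_abs ⟪ν, y⟫, abs_nonneg ⟪ν, y⟫]
  have hfloor : ∀ y ∈ ball v d, ∀ ij : ℤ × ℤ, Real.sqrt (t ^ 2 + m ij ^ 2) ≤ ‖y + ((ij.1 : ℝ) • a + (ij.2 : ℝ) • b)‖ :=
    fun y hy ij => site_floor hν hνa hνb hc (hty y hy) (by rw [mem_ball, dist_eq_norm] at hy; exact hy.le) ij
  have hne : ∀ y ∈ ball v d, ∀ ij : ℤ × ℤ, y + ((ij.1 : ℝ) • a + (ij.2 : ℝ) • b) ≠ 0 := fun y hy ij h => by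
    have := hfloor y hy ij; rw [h, norm_zero] at this; linarith [hr ij]
  have htv2 : t ^ 2 ≤ ⟪ν, v⟫ ^ 2 := hty v (mem_ball_self hd)
  have h := hasFDerivAt_tsum_of_isPreconnected (f := fun (ij : ℤ × ℤ) (y : E3) => pairForce (y + ((ij.1 : ℝ) • a + (ij.2 : ℝ) • b)))
    (f' := fun (ij : ℤ × ℤ) (y : E3) => pairJac (y + ((ij.1 : ℝ) • a + (ij.2 : ℝ) • b))) (x₀ := v) hμ isOpen_ball
    (convex_ball v d).isPreconnected (fun ij y hy => (hasFDerivAt_comp_add_right _).2 (hasFDerivAt_pairForce (hne y hy ij)))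
    (fun ij y hy => norm_pairJac_le (hr ij) (hfloor y hy ij)) (mem_ball_self hd) (summable_layer hν hνa hνb hab ht htv2)
    (mem_ball_self hd)
  exact h

/-- ★★ the OFFSET MAP `u ↦ layerForce a b (−u)` (the map whose secant forms the channel leaves bound) is differentiable on `|⟪ν, u⟫| ≥ t + d`
with Jacobian `−layerJac a b (−u)` — the "interlayer Hessian" `H(u)` of the certificate side. -/
theorem hasFDerivAt_layerForce_neg {ν a b u : E3} (hν : ‖ν‖ = 1) (hνa : ⟪ν, a⟫ = 0) (hνb : ⟪ν, b⟫ = 0)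
    (hab : LinearIndependent ℝ ![a, b]) {t d Rc ε : ℝ} (ht : 0 < t) (hd : 0 < d) (hε : 0 < ε)
    (hRc : ∀ ζ₁ ζ₂ : ℝ, |ζ₁| ≤ 1 / 2 → |ζ₂| ≤ 1 / 2 → ‖ζ₁ • a + ζ₂ • b‖ ≤ Rc)
    (hT : 0 < (1 + ε) * t ^ 2 - (1 + ε⁻¹) * (d + Rc) ^ 2) (htu : t + d ≤ |⟪ν, u⟫|) :
    HasFDerivAt (fun u => layerForce a b (-u)) (-layerJac a b (-u)) u := by
  have hF := hasFDerivAt_layerForce (v := -u) hν hνa hνb hab ht hd hε hRc hT (by rwa [inner_neg_right, abs_neg])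
  have h := hF.comp u (hasFDerivAt_id u).neg
  have he : (layerJac a b (-u)).comp (-ContinuousLinearMap.id ℝ E3) = -layerJac a b (-u) := by
    rw [ContinuousLinearMap.comp_neg, ContinuousLinearMap.comp_id]
  rw [he] at h
  exact h

end Summit.AtomisticToContinuum.Crystallization.Theorems.ChartedPlanarOrderChannelJacobian
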